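import Summits.BirchSwinnertonDyer.BirchSwinnertonDyer.Theorems.ManinLocalTwoThreeBracketSturm
import HarnessLib

/-!
# Bracket–Sturm packaging, file 3/4: the list model is faithful (`_spec` lemmas) and THE HEADLINE — `|c(P)| = 1` /
# `p ∤ c(P)` from integer coefficient tables by ONE `decide`

Cell bsd-f2-manin, route `ManinLocalTwoThree` (cruxes C2 `ManinOddAtFour` stmt-22967, C3 `ManinPrimeToThreeAtNine`
stmt-22968).  AUTHOR: planner seat -an gen 53 (TURNKEYS T-an-g53-BS v1.1 `bdf541700739eea7` and T-an-g53-EC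
`195407b5d8884464`, HOME/an/g53/); landed by prover seat p2 gen 29, who only SPLIT the two turnkeys into four tree files
(`…BracketSturmDefs` ⊂ `…BracketSturm` ⊂ `…BracketSturmLists` ⊂ `…EtaCoefficientTables`) for the 400-line lint, all
definitions going to the first; the Lean bodies are byte-identical to the turnkeys section by section.  Fact-free,
standard axioms, `--supports` helper; nothing here proves C2/C3 for all `N`, Manin's conjecture or BSD.

CONTENTS: §1 the `_spec` lemmas of `mulList`, `subList`, `smulList`, `thetaList`, `bracketList`, `cubicList`, `defectList`
(if the lists agree with power series below `M` through `ι : R →+* S`, so do the results); §2 the headline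
`abs_maninConstant_eq_one_of_defectList_eq_zero` / `not_dvd_maninConstant_of_defectList_eq_zero`: integer tables `a, b, c`
agreeing below `M` with `𝓠(A)`, `𝓠(B)`, `𝓠(P.f)`, integers `(e, c₀, c₂, c₃)` with `e ≠ 0`, `c₀ = 4e`, `c₂ = e·g₂(Λ₀)`,
`c₃ = e·g₃(Λ₀)` (Néron invariants of a globally minimal `W₀`), `defectList M e c₀ c₂ c₃ a b c = 0` below the Sturm bound and
two non-zero entries ⟹ `|c(P)| = 1` for every `X₀(N)`-datum `P` with the lattice clause.
[cite: Manin1972, Prop. 1.4] [cite: Sturm1987, Thm. 1] [cite: AgasheRibetStein2006, §§1–2] [cite: CremonaAlgorithms1997, §2.10]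
-/

set_option autoImplicit false
-- lint-debt: the directory name repeats the summit name (sibling precedent `ManinLocalTwoThreeRatioBridge.lean`)
set_option linter.dupNamespace false

noncomputable section

open Complex Filter Topology Set Function Asymptotics
open UpperHalfPlane hiding I
open scoped Real Topology Manifold MatrixGroups ModularForm PeriodPair
open CongruenceSubgroup Derivative PowerSeries
open Literature.NumberTheory.ModularForms
open Literature.NumberTheory.EllipticCurves Literature.NumberTheory.EllipticCurves.ModularForms

namespace Summit.BirchSwinnertonDyer.BirchSwinnertonDyer.Theorems.ManinLocalTwoThree.BracketSturm

open RatioBridge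

variable {N : ℕ} [NeZero N] {k : ℤ}

/-! ## §1 The list model is faithful -/

section Lists

variable {R : Type*} [CommRing R] {S : Type*} [CommRing S]

/-- `mulList` models the product. [folklore] -/
theorem mulList_spec (ι : R →+* S) {M : ℕ} {l₁ l₂ : List R} {ψ₁ ψ₂ : S⟦X⟧}
    (h₁ : ∀ n < M, ι (l₁.getD n 0) = coeff n ψ₁) (h₂ : ∀ n < M, ι (l₂.getD n 0) = coeff n ψ₂) :
    ∀ n < M, ι ((mulList M l₁ l₂).getD n 0) = coeff n (ψ₁ * ψ₂) := by
  intro n hn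
  rw [getD_mulList _ _ _ hn, map_sum, coeff_mul, Finset.Nat.sum_antidiagonal_eq_sum_range_succ_mk]
  refine Finset.sum_congr rfl fun i hi ↦ ?_
  have hi' : i < n + 1 := Finset.mem_range.mp hi
  rw [map_mul, h₁ i (by omega), h₂ (n - i) (by omega)]

/-- `subList` models the difference. [folklore] -/
theorem subList_spec (ι : R →+* S) {M : ℕ} {l₁ l₂ : List R} {ψ₁ ψ₂ : S⟦X⟧}
    (h₁ : ∀ n < M, ι (l₁.getD n 0) = coeff n ψ₁) (h₂ : ∀ n < M, ι (l₂.getD n 0) = coeff n ψ₂) :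
    ∀ n < M, ι ((subList M l₁ l₂).getD n 0) = coeff n (ψ₁ - ψ₂) := by
  intro n hn
  rw [subList, getD_map_range _ hn, map_sub, h₁ n hn, h₂ n hn, map_sub]

/-- `smulList` models multiplication by the constant `C (ι c)`. [folklore] -/
theorem smulList_spec (ι : R →+* S) {M : ℕ} (c : R) {l : List R} {ψ : S⟦X⟧}
    (h : ∀ n < M, ι (l.getD n 0) = coeff n ψ) :
    ∀ n < M, ι ((smulList M c l).getD n 0) = coeff n (PowerSeries.C (ι c) * ψ) := by
  intro n hn
  rw [smulList, getD_map_range _ hn, map_mul, h n hn, coeff_C_mul]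

/-- `thetaList` models `θ`. [folklore] -/
theorem thetaList_spec (ι : R →+* S) {M : ℕ} {l : List R} {ψ : S⟦X⟧} (h : ∀ n < M, ι (l.getD n 0) = coeff n ψ) :
    ∀ n < M, ι ((thetaList M l).getD n 0) = coeff n (theta ψ) := by
  intro n hn
  rw [thetaList, getD_map_range _ hn, map_mul, map_natCast, h n hn, coeff_theta]

/-- `bracketList` models the formal bracket. [folklore] -/
theorem bracketList_spec (ι : R →+* S) {M : ℕ} {a b : List R} {α β : S⟦X⟧}
    (ha : ∀ n < M, ι (a.getD n 0) = coeff n α) (hb : ∀ n < M, ι (b.getD n 0) = coeff n β) :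
    ∀ n < M, ι ((bracketList M a b).getD n 0) = coeff n (formalBracket α β) := by
  intro n hn
  rw [formalBracket]
  exact subList_spec ι (mulList_spec ι (thetaList_spec ι ha) hb) (mulList_spec ι ha (thetaList_spec ι hb)) n hn

/-- `cubicList` models the formal cubic. [folklore] -/
theorem cubicList_spec (ι : R →+* S) {M : ℕ} (c₀ c₂ c₃ : R) {a b : List R} {α β : S⟦X⟧}
    (ha : ∀ n < M, ι (a.getD n 0) = coeff n α) (hb : ∀ n < M, ι (b.getD n 0) = coeff n β) :
    ∀ n < M, ι ((cubicList M c₀ c₂ c₃ a b).getD n 0) = coeff n (formalCubic (ι c₀) (ι c₂) (ι c₃) α β) := by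
  intro n hn
  rw [formalCubic]
  exact subList_spec ι (subList_spec ι (smulList_spec ι c₀ (mulList_spec ι (mulList_spec ι ha ha) ha))
    (smulList_spec ι c₂ (mulList_spec ι ha (mulList_spec ι hb hb))))
    (smulList_spec ι c₃ (mulList_spec ι (mulList_spec ι hb hb) hb)) n hn

/-- **`defectList` models the formal defect.** [folklore] -/
theorem defectList_spec (ι : R →+* S) {M : ℕ} (e c₀ c₂ c₃ : R) {a b φ : List R} {α β ψ : S⟦X⟧}
    (ha : ∀ n < M, ι (a.getD n 0) = coeff n α) (hb : ∀ n < M, ι (b.getD n 0) = coeff n β)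
    (hφ : ∀ n < M, ι (φ.getD n 0) = coeff n ψ) :
    ∀ n < M, ι ((defectList M e c₀ c₂ c₃ a b φ).getD n 0) =
      coeff n (formalDefect (ι e) (ι c₀) (ι c₂) (ι c₃) α β ψ) := by
  intro n hn
  rw [formalDefect]
  have hW := bracketList_spec ι ha hb
  exact subList_spec ι (smulList_spec ι e (mulList_spec ι hW hW))
    (mulList_spec ι (mulList_spec ι (mulList_spec ι hφ hφ) (cubicList_spec ι c₀ c₂ c₃ ha hb)) hb) n hn

/-- Sanity check of the kernel evaluation on a toy instance (`M = 4`). [folklore] -/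
example : defectList 4 (1 : ℤ) 4 0 0 [1, 1] [1] [0, 1] = [0, 0, -3, -12] := by decide +kernel

end Lists

/-! ## §2 The headline: `|c(P)| = 1` / `p ∤ c(P)` from integer coefficient tables by `decide` -/

/-- **From tables to the three analytic facts**: integer lists `a, b, c` agreeing below `M` with `𝓠(A)`, `𝓠(B)`,
`𝓠(P.f)`, integers `(e, c₀, c₂, c₃)` with `e ≠ 0`, `c₀ = 4e`, `c₂ = e·g₂`, `c₃ = e·g₃`, the truncated defect
vanishing and one non-zero entry each of `b` and of the truncated cubic give: the first `M` coefficients of the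
defect form vanish, `B ≠ 0`, and `cubicForm ≠ 0`. [folklore] -/
theorem defectForm_coeff_eq_zero_of_defectList (A B : ModularForm (Gamma0 N) k) (f : CuspForm (Gamma0 N) 2)
    (g₂ g₃ : ℂ) {M : ℕ} (a b c : List ℤ)
    (ha : ∀ n < M, ((a.getD n 0 : ℤ) : ℂ) = (qExpansion 1 ⇑A).coeff n)
    (hb : ∀ n < M, ((b.getD n 0 : ℤ) : ℂ) = (qExpansion 1 ⇑B).coeff n)
    (hc : ∀ n < M, ((c.getD n 0 : ℤ) : ℂ) = (qExpansion 1 ⇑f).coeff n)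
    (e c₀ c₂ c₃ : ℤ) (he : e ≠ 0) (hc₀ : (c₀ : ℂ) = e * 4) (hc₂ : (c₂ : ℂ) = e * g₂) (hc₃ : (c₃ : ℂ) = e * g₃)
    (hzero : ∀ n < M, (defectList M e c₀ c₂ c₃ a b c).getD n 0 = 0) (hBnz : ∃ n < M, b.getD n 0 ≠ 0)
    (hCnz : ∃ n < M, (cubicList M c₀ c₂ c₃ a b).getD n 0 ≠ 0) :
    (∀ i < M, (qExpansion 1 ⇑(defectForm A B f g₂ g₃)).coeff i = 0) ∧ B ≠ 0 ∧ cubicForm A B g₂ g₃ ≠ 0 := by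
  set ι : ℤ →+* ℂ := Int.castRingHom ℂ with hι
  have ha' : ∀ n < M, ι (a.getD n 0) = coeff n (qExpansion 1 ⇑A) := fun n hn ↦ ha n hn
  have hb' : ∀ n < M, ι (b.getD n 0) = coeff n (qExpansion 1 ⇑B) := fun n hn ↦ hb n hn
  have hc' : ∀ n < M, ι (c.getD n 0) = coeff n (qExpansion 1 ⇑f) := fun n hn ↦ hc n hn
  have he' : (e : ℂ) ≠ 0 := Int.cast_ne_zero.mpr he
  have hιe : ι e = (e : ℂ) := rfl
  have hι₀ : ι c₀ = (e : ℂ) * 4 := hc₀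
  have hι₂ : ι c₂ = (e : ℂ) * g₂ := hc₂
  have hι₃ : ι c₃ = (e : ℂ) * g₃ := hc₃
  refine ⟨fun i hi ↦ ?_, ?_, ?_⟩
  · have h1 := defectList_spec ι e c₀ c₂ c₃ ha' hb' hc' i hi
    rw [hzero i hi, map_zero, hιe, hι₀, hι₂, hι₃, ← C_mul_formalDefect, ← qExpansion_defectForm, coeff_C_mul] at h1
    exact (mul_eq_zero.mp h1.symm).resolve_left he'
  · obtain ⟨n, hn, hbn⟩ := hBnz
    refine ne_zero_of_qExpansion_coeff_ne_zero B (n := n) ?_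
    rw [← hb n hn]
    exact_mod_cast hbn
  · obtain ⟨n, hn, hcn⟩ := hCnz
    have h1 := cubicList_spec ι c₀ c₂ c₃ ha' hb' n hn
    rw [hι₀, hι₂, hι₃, ← C_mul_formalCubic, ← qExpansion_cubicForm, coeff_C_mul] at h1
    refine ne_zero_of_qExpansion_coeff_ne_zero _ (n := n) fun h0 ↦ hcn ?_
    rw [h0, mul_zero] at h1
    have h2 : (((cubicList M c₀ c₂ c₃ a b).getD n 0 : ℤ) : ℂ) = 0 := h1
    exact_mod_cast h2

/-- **`|c(P)| = 1` BY A FINITE KERNEL CHECK.**  `W₀/ℚ` globally minimal with Néron period pair `L₀`; `P` an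
`X₀(N)`-datum of a globally minimal `W/ℚ` with the lattice clause; `A, B ∈ M_k(Γ₀(N))` (in practice `η`-quotient
forms with `x∘φ = A/B`); `M > ⌊(4k+4)μ₀(N)/12⌋`; INTEGER tables `a, b, c` of the first `M` coefficients of `A`, `B`,
`P.f`; integers `e ≠ 0`, `c₀ = 4e`, `c₂ = e·g₂(L₀)`, `c₃ = e·g₃(L₀)`; and three DECIDABLE facts about the tables.
Then `|c(P)| = 1`. [cite: Manin1972, Prop. 1.4] [cite: Sturm1987, Thm. 1] [cite: AgasheRibetStein2006, §§1–2]
[cite: CremonaAlgorithms1997, §2.10] -/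
theorem abs_maninConstant_eq_one_of_defectList_eq_zero
    (W₀ : WeierstrassCurve ℚ) [W₀.IsElliptic] [W₀.IsGloballyMinimal] (L₀ : PeriodPair)
    (hL₀ : IsNeronLatticeOf (W₀.baseChange ℂ) L₀)
    (W : WeierstrassCurve ℚ) [W.IsElliptic] [W.IsGloballyMinimal] (P : ModularParametrizationData W N)
    (hopt : ∀ z ∈ P.L.lattice, ∃ w ∈ periodLattice P.f, z = P.c * w)
    (A B : ModularForm (Gamma0 N) k) {M : ℕ} (hM : ((4 * k + 4) * gamma0Index N).toNat / 12 < M)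
    (a b c : List ℤ)
    (ha : ∀ n < M, ((a.getD n 0 : ℤ) : ℂ) = (qExpansion 1 ⇑A).coeff n)
    (hb : ∀ n < M, ((b.getD n 0 : ℤ) : ℂ) = (qExpansion 1 ⇑B).coeff n)
    (hc : ∀ n < M, ((c.getD n 0 : ℤ) : ℂ) = (qExpansion 1 ⇑P.f).coeff n)
    (e c₀ c₂ c₃ : ℤ) (he : e ≠ 0) (hc₀ : (c₀ : ℂ) = e * 4) (hc₂ : (c₂ : ℂ) = e * L₀.g₂) (hc₃ : (c₃ : ℂ) = e * L₀.g₃)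
    (hzero : ∀ n < M, (defectList M e c₀ c₂ c₃ a b c).getD n 0 = 0) (hBnz : ∃ n < M, b.getD n 0 ≠ 0)
    (hCnz : ∃ n < M, (cubicList M c₀ c₂ c₃ a b).getD n 0 ≠ 0) : |P.maninConstant| = 1 := by
  obtain ⟨h0, hB, hC⟩ := defectForm_coeff_eq_zero_of_defectList A B P.f L₀.g₂ L₀.g₃ a b c ha hb hc e c₀ c₂ c₃ he
    hc₀ hc₂ hc₃ hzero hBnz hCnz
  exact abs_maninConstant_eq_one_of_defectForm_coeff_eq_zero W₀ L₀ hL₀ W P hopt A B hM h0 hB hC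

/-- **`p ∤ c(P)` BY A FINITE KERNEL CHECK** (same hypotheses; `p` any integer with `|p| ≠ 1`, e.g. `p = 2` for C2,
`p = 3` for C3). [cite: Manin1972, Prop. 1.4] [cite: Sturm1987, Thm. 1] [cite: AgasheRibetStein2006, §§1–2] -/
theorem not_dvd_maninConstant_of_defectList_eq_zero
    (W₀ : WeierstrassCurve ℚ) [W₀.IsElliptic] [W₀.IsGloballyMinimal] (L₀ : PeriodPair)
    (hL₀ : IsNeronLatticeOf (W₀.baseChange ℂ) L₀)
    (W : WeierstrassCurve ℚ) [W.IsElliptic] [W.IsGloballyMinimal] (P : ModularParametrizationData W N)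
    (hopt : ∀ z ∈ P.L.lattice, ∃ w ∈ periodLattice P.f, z = P.c * w)
    (A B : ModularForm (Gamma0 N) k) {M : ℕ} (hM : ((4 * k + 4) * gamma0Index N).toNat / 12 < M)
    (a b c : List ℤ)
    (ha : ∀ n < M, ((a.getD n 0 : ℤ) : ℂ) = (qExpansion 1 ⇑A).coeff n)
    (hb : ∀ n < M, ((b.getD n 0 : ℤ) : ℂ) = (qExpansion 1 ⇑B).coeff n)
    (hc : ∀ n < M, ((c.getD n 0 : ℤ) : ℂ) = (qExpansion 1 ⇑P.f).coeff n)
    (e c₀ c₂ c₃ : ℤ) (he : e ≠ 0) (hc₀ : (c₀ : ℂ) = e * 4) (hc₂ : (c₂ : ℂ) = e * L₀.g₂) (hc₃ : (c₃ : ℂ) = e * L₀.g₃)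
    (hzero : ∀ n < M, (defectList M e c₀ c₂ c₃ a b c).getD n 0 = 0) (hBnz : ∃ n < M, b.getD n 0 ≠ 0)
    (hCnz : ∃ n < M, (cubicList M c₀ c₂ c₃ a b).getD n 0 ≠ 0) {p : ℤ} (hp : p.natAbs ≠ 1) :
    ¬ p ∣ P.maninConstant := by
  obtain ⟨h0, hB, hC⟩ := defectForm_coeff_eq_zero_of_defectList A B P.f L₀.g₂ L₀.g₃ a b c ha hb hc e c₀ c₂ c₃ he
    hc₀ hc₂ hc₃ hzero hBnz hCnz
  exact not_dvd_maninConstant_of_defectForm_eq_zero W₀ L₀ hL₀ W P hopt A B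
    (modularForm_eq_zero_of_coeff_eq_zero _ h0 hM) hB hC hp

end Summit.BirchSwinnertonDyer.BirchSwinnertonDyer.Theorems.ManinLocalTwoThree.BracketSturm

end
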